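/-
Copyright: the b2b-balaban T⁴-continuum CRUX team, row NE7b OWNER lineage `t4-ne7b-p1` (gen 136). Project licence.
-/
import Mathlib.Analysis.Convex.Integral
import Summits.QuantumFields.BalabanUV.T4Continuum.Spine.NE7b.SupGaussianQuadraticAbsorption
import Summits.QuantumFields.BalabanUV.T4Continuum.Spine.NE7b.SupGaussianRegulator

/-!
# THE ONE NUMBER OF THE DRESSED STEP IS EXTENSIVE AND OF THE SIZE OF THE COUPLING — (α4), THE VACUUM-ENERGY SHIFT PER STEP: the constant
# `c = ∫e^{−½ζᵀKζ − ⟨b,ζ⟩} dN(0,S)` of (385)∕(390) obeys TWO-SIDED bounds with no determinant in sight: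
#   (lower, Jensen)   `exp(−½·Σ_{x,y}K(x,y)S(x,y)) ≤ c`   — the Gaussian second moments `E[ζ_xζ_y] = S(x,y)`, `E[ζ_x] = 0`;
#   (upper, regulator) `c ≤ e^{(b·b)∕(2α)}·A^{#Y}`,  `A = (1−θ)^{−κγ∕(2θ)}`, `κ = 2λ + α`, whenever `−2λ·Σ_Yζ² ≤ ζᵀKζ` (the road's lower
#   matrix letter, (391)), `b` vanishes off `Y` ((392)), `S ⪯ γ′·1` with `S(x,x) ≤ γ` on `Y` and `κγ′ ≤ θ < 1` — AM–GM on the linear part and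
#   (288)'s Gaussian regulator cost on the cells `Y`;
# so `|log c| ≲ #Y × (coupling × γ′)`: the vacuum energy extracted per block per step is extensive and small per site (row NE7b, node U5c;
# (288)∕(385) + Mathlib's multivariate Gaussian moments and Jensen BY NAME; [folklore])

Cell `pub-balaban`, sub-cell `t4`, spine estimate NE7b (`T4WeightBudget.RelWeightBound`; the cell's OWN estimate — NOT PRINTED in
[Bałaban 1983–89], NOT PROVED).  Crux-route work under `Spine/NE7b/` by the row OWNER (`t4-ne7b-p1` gen 136, file (396)) under FREEZE
(0)'s crux-prover clause, on gen 135's SCOPING-d7 DECISION (3)∕(α4) («vacuum-energy extraction — one number per block per step; its size»);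
NOTHING of Bałaban's is named as a Lean object, valued or asserted; no `T4Continuum/Support` leaf typed; no `def`, no notation; zero `sorry`.
Imports (BY NAME): Mathlib's `ConvexOn.map_integral_le` (Jensen), `covariance_eval_multivariateGaussian`, `IsGaussian.memLp_two_id`,
`integral_id_multivariateGaussian`; the OWNER's (385) `…SupGaussianQuadraticAbsorption` (`absorption_const_cov`), (288) `…SupGaussianRegulator`
(`integral_exp_half_sq_on_le`, `integrable_exp_half_sq_on`).

WHAT IS PROVED ([folklore]):
* §1 Gaussian moments on `ℝ^ι`: `memLp_two_eval`, `integral_eval_eq_zero`, `integral_eval_mul_eval` (`E[ζ_xζ_y] = S(x,y)`),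
  `integral_dot_eq_zero`, `integrable_quadratic_form`, `integral_quadratic_form` (`E[ζᵀKζ] = Σ_{x,y}K(x,y)S(x,y)`);
* §2 `integrable_tilt_weight` (the weight `e^{−½ζᵀKζ−⟨b,ζ⟩}` is integrable when `S ≻ 0`, `S⁻¹+K ≻ 0` — its integral is (385)'s positive
  closed form);
* §3 **`dressed_const_lower`** (Jensen: `exp(−½Σ_{x,y}K(x,y)S(x,y)) ≤ c`);
* §4 `neg_dot_le_of_support` (AM–GM: `−⟨b,z⟩ ≤ (b·b)∕(2α) + (α∕2)Σ_Y z²` for `b` vanishing off `Y`), **`dressed_const_upper`**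
  (`c ≤ e^{(b·b)∕(2α)}·((1−θ)^{−κγ∕(2θ)})^{#Y}`); §5 toy.

HONEST (what this is NOT).  Bookkeeping of one number: no determinant identity is used or claimed beyond (385)'s; the entrywise size of
`Σ K(x,y)S(x,y)` (`≤ #Y·(Λ_w+4λ_w)γ′` by (395)'s operator letter) is the successor's one-liner; no contraction; scalar skeleton ((A3), NC-NE7b-α
UNRULED); nothing of Bałaban's asserted.  BY-NAME EFFECT ON THE WALL: NONE.  NE7b NOT PRINTED ∕ NOT PROVED; spine PROVED 0∕9; rung (B)+1 — the
programme's measures remain FINITE-torus statements; NOT the mass gap, NOT Clay.  HONEST DEPENDENCY: continuum YM on T⁴ ⇐ BetaPertH ∧ nine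
spine estimates (0∕9 proved); BetaPertH ⇐ (D1) ∧ (D4) ∧ CAP+tail; G-an2-4 gates asym, D1 and NE2∕3∕4.
-/

set_option autoImplicit false

noncomputable section

namespace Summit.QuantumFields.BalabanUV.T4Continuum.NE7b.SupDressedConstantBounds

open MeasureTheory ProbabilityTheory Finset Real Matrix
open scoped BigOperators
open SupGaussianQuadraticAbsorption (absorption_const_cov)
open SupGaussianRegulator (integral_exp_half_sq_on_le integrable_exp_half_sq_on)

variable {ι : Type} [Fintype ι] [DecidableEq ι]

/-! ## §1. Gaussian moments on `ℝ^ι` -/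

/-- Coordinates are square integrable under `N(0,S)`. [folklore] -/
theorem memLp_two_eval (S : Matrix ι ι ℝ) (i : ι) :
    MemLp (fun x : EuclideanSpace ℝ ι => x i) 2 (multivariateGaussian 0 S) :=
  (EuclideanSpace.proj i : EuclideanSpace ℝ ι →L[ℝ] ℝ).comp_memLp' (IsGaussian.memLp_two_id (μ := multivariateGaussian 0 S))

/-- Products of coordinates are integrable under `N(0,S)`. [folklore] -/
theorem integrable_eval_mul_eval (S : Matrix ι ι ℝ) (i j : ι) :
    Integrable (fun x : EuclideanSpace ℝ ι => x i * x j) (multivariateGaussian 0 S) :=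
  (memLp_two_eval S i).integrable_mul (memLp_two_eval S j)

/-- Coordinates are integrable under `N(0,S)`. [folklore] -/
theorem integrable_eval (S : Matrix ι ι ℝ) (i : ι) : Integrable (fun x : EuclideanSpace ℝ ι => x i) (multivariateGaussian 0 S) :=
  (memLp_two_eval S i).integrable (by norm_num)

/-- **`E[ζ_x] = 0`** under `N(0,S)`. [folklore] -/
theorem integral_eval_eq_zero (S : Matrix ι ι ℝ) (i : ι) : ∫ x : EuclideanSpace ℝ ι, x i ∂(multivariateGaussian 0 S) = 0 := by
  have h := (EuclideanSpace.proj i : EuclideanSpace ℝ ι →L[ℝ] ℝ).integral_comp_comm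
    (IsGaussian.integrable_id (μ := multivariateGaussian 0 S))
  simp only [id, integral_id_multivariateGaussian] at h
  simpa using h

/-- **`E[ζ_xζ_y] = S(x,y)`** under `N(0,S)` for `S ⪰ 0` (Mathlib's covariance of coordinates, centred). [folklore] -/
theorem integral_eval_mul_eval {S : Matrix ι ι ℝ} (hS : S.PosSemidef) (i j : ι) :
    ∫ x : EuclideanSpace ℝ ι, x i * x j ∂(multivariateGaussian 0 S) = S i j := by
  have hcov := covariance_eval_multivariateGaussian (μ := 0) hS i j
  rw [covariance_eq_sub (memLp_two_eval S i) (memLp_two_eval S j)] at hcov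
  have h0 : (multivariateGaussian 0 S)[fun x : EuclideanSpace ℝ ι => x i] = 0 := integral_eval_eq_zero S i
  rw [h0, zero_mul, sub_zero] at hcov
  simpa only [Pi.mul_apply] using hcov

/-- `E[⟨b,ζ⟩] = 0`. [folklore] -/
theorem integral_dot_eq_zero (S : Matrix ι ι ℝ) (b : ι → ℝ) :
    ∫ x : EuclideanSpace ℝ ι, b ⬝ᵥ WithLp.ofLp x ∂(multivariateGaussian 0 S) = 0 := by
  simp only [dotProduct]
  rw [integral_finsetSum _ fun i _ => (integrable_eval S i).const_mul (b i)]
  refine Finset.sum_eq_zero fun i _ => ?_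
  rw [integral_const_mul]
  simp [integral_eval_eq_zero S i]

/-- The quadratic form is integrable. [folklore] -/
theorem integrable_quadratic_form (S K : Matrix ι ι ℝ) :
    Integrable (fun x : EuclideanSpace ℝ ι => WithLp.ofLp x ⬝ᵥ K *ᵥ WithLp.ofLp x) (multivariateGaussian 0 S) := by
  have e : (fun x : EuclideanSpace ℝ ι => WithLp.ofLp x ⬝ᵥ K *ᵥ WithLp.ofLp x) =
      fun x => ∑ i, ∑ j, K i j * (x i * x j) := by
    funext x
    simp only [dotProduct, mulVec, Finset.mul_sum]
    refine Finset.sum_congr rfl fun i _ => Finset.sum_congr rfl fun j _ => ?_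
    ring
  rw [e]
  exact integrable_finsetSum _ fun i _ => integrable_finsetSum _ fun j _ => (integrable_eval_mul_eval S i j).const_mul _

/-- **`E[ζᵀKζ] = Σ_{x,y}K(x,y)S(x,y)`** under `N(0,S)`, `S ⪰ 0`. [folklore] -/
theorem integral_quadratic_form {S : Matrix ι ι ℝ} (hS : S.PosSemidef) (K : Matrix ι ι ℝ) :
    ∫ x : EuclideanSpace ℝ ι, WithLp.ofLp x ⬝ᵥ K *ᵥ WithLp.ofLp x ∂(multivariateGaussian 0 S) = ∑ i, ∑ j, K i j * S i j := by
  have e : (fun x : EuclideanSpace ℝ ι => WithLp.ofLp x ⬝ᵥ K *ᵥ WithLp.ofLp x) =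
      fun x => ∑ i, ∑ j, K i j * (x i * x j) := by
    funext x
    simp only [dotProduct, mulVec, Finset.mul_sum]
    refine Finset.sum_congr rfl fun i _ => Finset.sum_congr rfl fun j _ => ?_
    ring
  rw [e, integral_finsetSum _ fun i _ => integrable_finsetSum _ fun j _ => (integrable_eval_mul_eval S i j).const_mul _]
  refine Finset.sum_congr rfl fun i _ => ?_
  rw [integral_finsetSum _ fun j _ => (integrable_eval_mul_eval S i j).const_mul _]
  refine Finset.sum_congr rfl fun j _ => ?_
  rw [integral_const_mul, integral_eval_mul_eval hS]

/-! ## §2. The tilt weight is integrable -/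

/-- **The weight `e^{−½ζᵀKζ−⟨b,ζ⟩}` is integrable under `N(0,S)`** when `S ≻ 0`, `S⁻¹+K ≻ 0` (its integral is (385)'s positive closed
form; a non-integrable function would integrate to `0`). [folklore] -/
theorem integrable_tilt_weight {S : Matrix ι ι ℝ} (hS : S.PosDef) (K : Matrix ι ι ℝ) (hQ : (S⁻¹ + K).PosDef) (b : ι → ℝ) :
    Integrable (fun x : EuclideanSpace ℝ ι => Real.exp (-(WithLp.ofLp x ⬝ᵥ K *ᵥ WithLp.ofLp x) / 2 - b ⬝ᵥ WithLp.ofLp x))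
      (multivariateGaussian 0 S) := by
  by_contra h
  have hpos := (absorption_const_cov hS K hQ (-b)).2
  simp only [neg_dotProduct, ← sub_eq_add_neg] at hpos
  rw [integral_undef h] at hpos
  exact lt_irrefl _ hpos

/-! ## §3. The lower bound (Jensen) -/

/-- **THE ONE NUMBER IS BOUNDED BELOW**: `S ≻ 0`, `S⁻¹+K ≻ 0` ⟹ `exp(−½·Σ_{x,y}K(x,y)S(x,y)) ≤ ∫e^{−½ζᵀKζ−⟨b,ζ⟩}dN(0,S)`. [folklore] -/
theorem dressed_const_lower {S : Matrix ι ι ℝ} (hS : S.PosDef) (K : Matrix ι ι ℝ) (hQ : (S⁻¹ + K).PosDef) (b : ι → ℝ) :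
    Real.exp (-(∑ i, ∑ j, K i j * S i j) / 2) ≤
      ∫ x : EuclideanSpace ℝ ι, Real.exp (-(WithLp.ofLp x ⬝ᵥ K *ᵥ WithLp.ofLp x) / 2 - b ⬝ᵥ WithLp.ofLp x)
        ∂(multivariateGaussian 0 S) := by
  have hlin : Integrable (fun x : EuclideanSpace ℝ ι => b ⬝ᵥ WithLp.ofLp x) (multivariateGaussian 0 S) := by
    simp only [dotProduct]
    exact integrable_finsetSum _ fun i _ => (integrable_eval S i).const_mul (b i)
  have hq2 : Integrable (fun x : EuclideanSpace ℝ ι => -(WithLp.ofLp x ⬝ᵥ K *ᵥ WithLp.ofLp x) / 2) (multivariateGaussian 0 S) :=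
    ((integrable_quadratic_form S K).neg).div_const 2
  have hfi : Integrable (fun x : EuclideanSpace ℝ ι => -(WithLp.ofLp x ⬝ᵥ K *ᵥ WithLp.ofLp x) / 2 - b ⬝ᵥ WithLp.ofLp x)
      (multivariateGaussian 0 S) := hq2.sub hlin
  have hmean : ∫ x : EuclideanSpace ℝ ι, (-(WithLp.ofLp x ⬝ᵥ K *ᵥ WithLp.ofLp x) / 2 - b ⬝ᵥ WithLp.ofLp x)
      ∂(multivariateGaussian 0 S) = -(∑ i, ∑ j, K i j * S i j) / 2 := by
    rw [integral_sub hq2 hlin, integral_div, integral_neg, integral_quadratic_form hS.posSemidef, integral_dot_eq_zero, sub_zero]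
  have hJ := ConvexOn.map_integral_le (μ := multivariateGaussian 0 S) (s := Set.univ) (g := Real.exp)
    (f := fun x : EuclideanSpace ℝ ι => -(WithLp.ofLp x ⬝ᵥ K *ᵥ WithLp.ofLp x) / 2 - b ⬝ᵥ WithLp.ofLp x)
    convexOn_exp Real.continuous_exp.continuousOn isClosed_univ (Filter.Eventually.of_forall fun _ => Set.mem_univ _) hfi
    (integrable_tilt_weight hS K hQ b)
  rw [hmean] at hJ
  exact hJ

/-! ## §4. The upper bound (regulator) -/

omit [DecidableEq ι] in
/-- **AM–GM on the linear part**: `b` vanishes off `Y`, `0 < α` ⟹ `−⟨b,z⟩ ≤ (b·b)∕(2α) + (α∕2)·Σ_Y z²`. [folklore] -/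
theorem neg_dot_le_of_support (Y : Finset ι) {b : ι → ℝ} (hoff : ∀ i, i ∉ Y → b i = 0) {α : ℝ} (hα : 0 < α) (z : ι → ℝ) :
    -(b ⬝ᵥ z) ≤ (b ⬝ᵥ b) / (2 * α) + α / 2 * ∑ i ∈ Y, z i ^ 2 := by
  classical
  have e : b ⬝ᵥ z = ∑ i ∈ Y, b i * z i := by
    rw [dotProduct]
    refine (Finset.sum_subset (Finset.subset_univ Y) fun i _ hi => ?_).symm
    rw [hoff i hi, zero_mul]
  have hbb : ∑ i ∈ Y, b i ^ 2 ≤ b ⬝ᵥ b := by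
    rw [dotProduct]
    have : ∑ i ∈ Y, b i ^ 2 = ∑ i ∈ Y, b i * b i := Finset.sum_congr rfl fun i _ => pow_two _
    rw [this]
    exact Finset.sum_le_univ_sum_of_nonneg fun i => mul_self_nonneg (b i)
  have hpt : ∀ i ∈ Y, -(b i * z i) ≤ b i ^ 2 / (2 * α) + α / 2 * z i ^ 2 := fun i _ => by
    have h := sq_nonneg (b i / α + z i)
    have hα' : 0 < α := hα
    have e2 : α * (b i / α + z i) ^ 2 = 2 * (b i ^ 2 / (2 * α) + α / 2 * z i ^ 2 + b i * z i) := by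
      field_simp; ring
    nlinarith [mul_nonneg hα'.le h]
  rw [e, ← Finset.sum_neg_distrib]
  calc ∑ i ∈ Y, -(b i * z i) ≤ ∑ i ∈ Y, (b i ^ 2 / (2 * α) + α / 2 * z i ^ 2) := Finset.sum_le_sum hpt
    _ = (∑ i ∈ Y, b i ^ 2) / (2 * α) + α / 2 * ∑ i ∈ Y, z i ^ 2 := by rw [Finset.sum_add_distrib, Finset.sum_div, Finset.mul_sum]
    _ ≤ (b ⬝ᵥ b) / (2 * α) + α / 2 * ∑ i ∈ Y, z i ^ 2 := by
        have := div_le_div_of_nonneg_right hbb (by positivity : (0 : ℝ) ≤ 2 * α)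
        linarith

/-- **THE ONE NUMBER IS BOUNDED ABOVE**: `S ≻ 0` with `γ′·1 − S ⪰ 0`, `S(x,x) ≤ γ` on `Y`; `S⁻¹+K ≻ 0`, the lower matrix letter in `Y`-form
`−2λ·Σ_Yz² ≤ zᵀKz`; `b` vanishing off `Y`; `0 < α`, `0 ≤ λ`, `0 < θ < 1`, `(2λ+α)γ′ ≤ θ` ⟹
`∫e^{−½ζᵀKζ−⟨b,ζ⟩}dN(0,S) ≤ e^{(b·b)∕(2α)}·((1−θ)^{−(2λ+α)γ∕(2θ)})^{#Y}`. [folklore] -/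
theorem dressed_const_upper {S : Matrix ι ι ℝ} {γ' γ : ℝ} (hS : S.PosDef) (hSγ : (γ' • (1 : Matrix ι ι ℝ) - S).PosSemidef) (Y : Finset ι)
    (hdiag : ∀ i ∈ Y, S i i ≤ γ) (K : Matrix ι ι ℝ) (hQ : (S⁻¹ + K).PosDef) {lam : ℝ} (hlam : 0 ≤ lam)
    (hKlo : ∀ z : ι → ℝ, -(2 * lam * ∑ i ∈ Y, z i ^ 2) ≤ z ⬝ᵥ K *ᵥ z) {b : ι → ℝ} (hoff : ∀ i, i ∉ Y → b i = 0) {α θ : ℝ}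
    (hα : 0 < α) (hθ0 : 0 < θ) (hθ1 : θ < 1) (hκθ : (2 * lam + α) * γ' ≤ θ) :
    ∫ x : EuclideanSpace ℝ ι, Real.exp (-(WithLp.ofLp x ⬝ᵥ K *ᵥ WithLp.ofLp x) / 2 - b ⬝ᵥ WithLp.ofLp x) ∂(multivariateGaussian 0 S) ≤
      Real.exp ((b ⬝ᵥ b) / (2 * α)) * ((1 - θ) ^ (-((2 * lam + α) * γ / (2 * θ)))) ^ Y.card := by
  have hκ : 0 ≤ 2 * lam + α := by positivity
  -- pointwise domination of the weight
  have hpt : ∀ x : EuclideanSpace ℝ ι, Real.exp (-(WithLp.ofLp x ⬝ᵥ K *ᵥ WithLp.ofLp x) / 2 - b ⬝ᵥ WithLp.ofLp x) ≤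
      Real.exp ((b ⬝ᵥ b) / (2 * α)) * Real.exp ((2 * lam + α) * (∑ i ∈ Y, x i ^ 2) / 2) := fun x => by
    rw [← Real.exp_add]
    refine Real.exp_le_exp.2 ?_
    have h1 := hKlo (WithLp.ofLp x)
    have h2 := neg_dot_le_of_support Y hoff hα (WithLp.ofLp x)
    nlinarith [h1, h2]
  have hint := integrable_exp_half_sq_on hS.posSemidef hSγ hκ hθ1 hκθ Y
  have hbound := integral_exp_half_sq_on_le hS.posSemidef hSγ hκ hθ0 hθ1 hκθ Y hdiag
  calc ∫ x : EuclideanSpace ℝ ι, Real.exp (-(WithLp.ofLp x ⬝ᵥ K *ᵥ WithLp.ofLp x) / 2 - b ⬝ᵥ WithLp.ofLp x) ∂(multivariateGaussian 0 S)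
      ≤ ∫ x : EuclideanSpace ℝ ι, Real.exp ((b ⬝ᵥ b) / (2 * α)) * Real.exp ((2 * lam + α) * (∑ i ∈ Y, x i ^ 2) / 2)
          ∂(multivariateGaussian 0 S) :=
        integral_mono (integrable_tilt_weight hS K hQ b) (hint.const_mul _) hpt
    _ = Real.exp ((b ⬝ᵥ b) / (2 * α)) * ∫ x : EuclideanSpace ℝ ι, Real.exp ((2 * lam + α) * (∑ i ∈ Y, x i ^ 2) / 2)
          ∂(multivariateGaussian 0 S) := integral_const_mul _ _
    _ ≤ Real.exp ((b ⬝ᵥ b) / (2 * α)) * ((1 - θ) ^ (-((2 * lam + α) * γ / (2 * θ)))) ^ Y.card :=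
        mul_le_mul_of_nonneg_left hbound (Real.exp_pos _).le

/-! ## §5. Toy -/

/-- Toy (§4): with `b = 0` the AM–GM bound reads `0 ≤ 0 + (α∕2)Σz²`. -/
example (Y : Finset ι) (z : ι → ℝ) : -((0 : ι → ℝ) ⬝ᵥ z) ≤ ((0 : ι → ℝ) ⬝ᵥ 0) / (2 * 1) + 1 / 2 * ∑ i ∈ Y, z i ^ 2 :=
  neg_dot_le_of_support Y (fun _ _ => rfl) one_pos z

end Summit.QuantumFields.BalabanUV.T4Continuum.NE7b.SupDressedConstantBounds
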